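import Summits.SmoothPoincare4.SmoothPoincare4.Theorems.ShadowApproximation.Negative.UnitTwist

/-!
# `ShadowApproximation` — negative-side support III(c): the handle slide `σ₀₁`, a unipotent symmetry of the standard trisection

Support file for the crux `CongruenceShadows.ShadowApproximation` (stmt-SmoothPoincare4-14595),
standing disprover's work file `Cruxes/ShadowApproximation/Disproof.lean` §6 (cycle 2), companion of
`Negative/LevelSymmetriesFalse.lean` (the units obstruction).

Question left by the units obstruction: after normalising the unit scalars of a level symmetry `ψ`
of the standard shadow triple `(N₀M, N₁M, N₂M)` to `±1`, does `ψ` lift to `Stab N₀ ∩ Stab N₁ ∩ Stab N₂`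
modulo `M`? At an abelian level `M ⊇ [S₃,S₃]` the joint stabiliser of the three Lagrangian shadows
`L₀ = ⟨a₀,a₁,b₂⟩, L₁ = ⟨a₀,b₁,a₂⟩, L₂ = ⟨b₀,a₁,a₂⟩` in `Sp^±(H₁ ⊗ R)` is a torus (unit scalings
`aᵢ ↦ uᵢaᵢ, bᵢ ↦ uᵢ⁻¹bᵢ`) times a 3-parameter UNIPOTENT group (`b₀ ↦ b₀ + x a₁ + y a₂`,
`b₁ ↦ b₁ + x a₀ + z a₂`, `b₂ ↦ b₂ + y a₀ + z a₁`). This file shows the unipotent part LIFTS: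

* `slide01 : S ≃* S` — the handle slide `σ₀₁`: `a₀ ↦ a₀`, `b₀ ↦ a₀⁻¹a₁a₀·b₀`, `a₁ ↦ a₀⁻¹a₁a₀`,
  `b₁ ↦ a₁b₁a₁⁻¹·a₀`, handle `2` conjugated by `a₁` (sends the relator to its `a₁`-conjugate; explicit
  inverse `slideInvFun`; found by a free-group search, seat folder `py/search_mix2.py`,
  `py/slide_check.py`);
* `slide01_stab` — `σ₀₁(Nᵢ) = Nᵢ` for `i = 0, 1, 2`: a genuine symmetry of the standard genus-3
  trisection of `S⁴`;
* `toCommGroup_comp_slide01` — on every abelian quotient `σ₀₁` is the transvection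
  `u : b₀ ↦ b₀ + a₁, b₁ ↦ b₁ + a₀` (the `x`-direction; the `y`, `z` directions follow by the handle
  symmetries of `N`);
* `unipotent_level_symmetry_lifts` — packaged.

Consequence (Disproof.lean §6, on paper): at abelian levels the image of the trisection's symmetry
group in the joint stabiliser is `signs ⋉ unipotents`; a level symmetry lifts iff its unit scalars
are `±1` — the units obstruction is the ONLY abelian one, and the crux's coherence problem starts
in earnest at the metabelian / Johnson levels.
-/

noncomputable section

namespace Summit.SmoothPoincare4.SmoothPoincare4.Theorems.ShadowApproximation.Negative

set_option linter.dupNamespace false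

open Literature.Topology.FourManifolds
open Summit.SmoothPoincare4.SmoothPoincare4.Theses.CongruenceShadows
open SurfaceGroup

/-! ## The handle slide `σ₀₁` -/

/-- Generator images of the slide `σ₀₁`: `a₀ ↦ a₀`, `b₀ ↦ a₀⁻¹a₁a₀·b₀`, `a₁ ↦ a₀⁻¹a₁a₀`,
`b₁ ↦ a₁b₁a₁⁻¹·a₀`, and handle `2` conjugated by `a₁`. [folklore] -/
def slideFun : surfaceGen 3 → S
  | (0, false) => a 0
  | (0, true) => (a 0)⁻¹ * a 1 * a 0 * b 0
  | (1, false) => (a 0)⁻¹ * a 1 * a 0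
  | (1, true) => a 1 * b 1 * (a 1)⁻¹ * a 0
  | (2, false) => a 1 * a 2 * (a 1)⁻¹
  | (2, true) => a 1 * b 2 * (a 1)⁻¹

/-- Generator images of `σ₀₁⁻¹`: `b₀ ↦ a₁⁻¹b₀`, `a₁ ↦ a₀a₁a₀⁻¹`, `b₁ ↦ (a₀a₁⁻¹a₀⁻¹)b₁(a₁a₀⁻¹)`,
handle `2` conjugated by `a₀a₁⁻¹a₀⁻¹`. [folklore] -/
def slideInvFun : surfaceGen 3 → S
  | (0, false) => a 0
  | (0, true) => (a 1)⁻¹ * b 0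
  | (1, false) => a 0 * a 1 * (a 0)⁻¹
  | (1, true) => a 0 * (a 1)⁻¹ * (a 0)⁻¹ * b 1 * a 1 * (a 0)⁻¹
  | (2, false) => a 0 * (a 1)⁻¹ * (a 0)⁻¹ * a 2 * (a 0 * a 1 * (a 0)⁻¹)
  | (2, true) => a 0 * (a 1)⁻¹ * (a 0)⁻¹ * b 2 * (a 0 * a 1 * (a 0)⁻¹)

/-- `σ₀₁` sends the relator to its conjugate by `a₁`, hence kills it. [folklore] -/
theorem slideFun_rel : FreeGroup.lift slideFun (surfaceRelator 3) = 1 := by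
  rw [lift_surfaceRelator_three]
  have h := rel_three
  calc _ = a 1 * (a 0 * b 0 * (a 0)⁻¹ * (b 0)⁻¹ * (a 1 * b 1 * (a 1)⁻¹ * (b 1)⁻¹ *
      (a 2 * b 2 * (a 2)⁻¹ * (b 2)⁻¹))) * (a 1)⁻¹ := by
        simp only [slideFun]; group
    _ = 1 := by rw [h]; group

/-- `σ₀₁⁻¹` sends the relator to its conjugate by `a₀a₁⁻¹a₀⁻¹`, hence kills it. [folklore] -/
theorem slideInvFun_rel : FreeGroup.lift slideInvFun (surfaceRelator 3) = 1 := by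
  rw [lift_surfaceRelator_three]
  have h := rel_three
  calc _ = a 0 * (a 1)⁻¹ * (a 0)⁻¹ * (a 0 * b 0 * (a 0)⁻¹ * (b 0)⁻¹ *
      (a 1 * b 1 * (a 1)⁻¹ * (b 1)⁻¹ * (a 2 * b 2 * (a 2)⁻¹ * (b 2)⁻¹))) * (a 0 * a 1 * (a 0)⁻¹) := by
        simp only [slideInvFun]; group
    _ = 1 := by rw [h]; group

/-- `σ₀₁` as an endomorphism. [folklore] -/
def slideHom : S →* S := liftHom slideFun slideFun_rel
/-- `σ₀₁⁻¹` as an endomorphism. [folklore] -/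
def slideInvHom : S →* S := liftHom slideInvFun slideInvFun_rel

/-- Case analysis over the six generators of `S₃` with clean numerals. [folklore] -/
theorem surfaceGen_three_cases {P : surfaceGen 3 → Prop} (h0 : P (0, false)) (h1 : P (0, true))
    (h2 : P (1, false)) (h3 : P (1, true)) (h4 : P (2, false)) (h5 : P (2, true)) : ∀ p, P p := by
  rintro ⟨i, _ | _⟩ <;> fin_cases i <;> assumption

/-- `σ₀₁⁻¹ ∘ σ₀₁ = id`. [folklore] -/
theorem slideInv_comp : slideInvHom.comp slideHom = MonoidHom.id _ := by
  refine PresentedGroup.ext (surfaceGen_three_cases ?_ ?_ ?_ ?_ ?_ ?_) <;>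
    simp only [MonoidHom.comp_apply, MonoidHom.id_apply, of_eq_a, of_eq_b, slideHom, slideInvHom,
      liftHom_a, liftHom_b, slideFun, slideInvFun, map_mul, map_inv] <;>
    group

/-- `σ₀₁ ∘ σ₀₁⁻¹ = id`. [folklore] -/
theorem slide_comp_inv : slideHom.comp slideInvHom = MonoidHom.id _ := by
  refine PresentedGroup.ext (surfaceGen_three_cases ?_ ?_ ?_ ?_ ?_ ?_) <;>
    simp only [MonoidHom.comp_apply, MonoidHom.id_apply, of_eq_a, of_eq_b, slideHom, slideInvHom,
      liftHom_a, liftHom_b, slideFun, slideInvFun, map_mul, map_inv] <;>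
    group

/-- **The handle slide `σ₀₁ ∈ Aut S₃`.** [folklore] -/
def slide01 : S ≃* S := MonoidHom.toMulEquiv slideHom slideInvHom slideInv_comp slide_comp_inv

/-- `σ₀₁` on `a₀`. [folklore] -/
@[simp] theorem slide01_a0 : slide01 (a 0) = a 0 := by
  simp [slide01, slideHom, slideFun, ← of_eq_a]
/-- `σ₀₁` on `b₀`. [folklore] -/
@[simp] theorem slide01_b0 : slide01 (b 0) = (a 0)⁻¹ * a 1 * a 0 * b 0 := by
  simp [slide01, slideHom, slideFun, ← of_eq_b]
/-- `σ₀₁` on `a₁`. [folklore] -/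
@[simp] theorem slide01_a1 : slide01 (a 1) = (a 0)⁻¹ * a 1 * a 0 := by
  simp [slide01, slideHom, slideFun, ← of_eq_a]
/-- `σ₀₁` on `b₁`. [folklore] -/
@[simp] theorem slide01_b1 : slide01 (b 1) = a 1 * b 1 * (a 1)⁻¹ * a 0 := by
  simp [slide01, slideHom, slideFun, ← of_eq_b]
/-- `σ₀₁` on `a₂`. [folklore] -/
@[simp] theorem slide01_a2 : slide01 (a 2) = a 1 * a 2 * (a 1)⁻¹ := by
  simp [slide01, slideHom, slideFun, ← of_eq_a]
/-- `σ₀₁` on `b₂`. [folklore] -/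
@[simp] theorem slide01_b2 : slide01 (b 2) = a 1 * b 2 * (a 1)⁻¹ := by
  simp [slide01, slideHom, slideFun, ← of_eq_b]
/-- `σ₀₁⁻¹` on `a₀`. [folklore] -/
@[simp] theorem slide01_symm_a0 : slide01.symm (a 0) = a 0 := by
  simp [slide01, slideInvHom, slideInvFun, ← of_eq_a]
/-- `σ₀₁⁻¹` on `b₀`. [folklore] -/
@[simp] theorem slide01_symm_b0 : slide01.symm (b 0) = (a 1)⁻¹ * b 0 := by
  simp [slide01, slideInvHom, slideInvFun, ← of_eq_b]
/-- `σ₀₁⁻¹` on `a₁`. [folklore] -/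
@[simp] theorem slide01_symm_a1 : slide01.symm (a 1) = a 0 * a 1 * (a 0)⁻¹ := by
  simp [slide01, slideInvHom, slideInvFun, ← of_eq_a]
/-- `σ₀₁⁻¹` on `b₁`. [folklore] -/
@[simp] theorem slide01_symm_b1 :
    slide01.symm (b 1) = a 0 * (a 1)⁻¹ * (a 0)⁻¹ * b 1 * a 1 * (a 0)⁻¹ := by
  simp [slide01, slideInvHom, slideInvFun, ← of_eq_b]
/-- `σ₀₁⁻¹` on `a₂`. [folklore] -/
@[simp] theorem slide01_symm_a2 :
    slide01.symm (a 2) = a 0 * (a 1)⁻¹ * (a 0)⁻¹ * a 2 * (a 0 * a 1 * (a 0)⁻¹) := by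
  simp [slide01, slideInvHom, slideInvFun, ← of_eq_a]
/-- `σ₀₁⁻¹` on `b₂`. [folklore] -/
@[simp] theorem slide01_symm_b2 :
    slide01.symm (b 2) = a 0 * (a 1)⁻¹ * (a 0)⁻¹ * b 2 * (a 0 * a 1 * (a 0)⁻¹) := by
  simp [slide01, slideInvHom, slideInvFun, ← of_eq_b]

/-! ## `σ₀₁` is a symmetry of the standard trisection -/

/-- Membership helper: a conjugate `g x g⁻¹` of an element of `Nᵢ`. [folklore] -/
theorem conj_mem_N (i : Fin 3) {x : S} (hx : x ∈ s4Kernels i) (g : S) : g * x * g⁻¹ ∈ s4Kernels i :=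
  (s4Kernels_normal i).conj_mem x hx g

/-- Membership helper: `g⁻¹ x g`. [folklore] -/
theorem conj_mem_N' (i : Fin 3) {x : S} (hx : x ∈ s4Kernels i) (g : S) : g⁻¹ * x * g ∈ s4Kernels i := by
  simpa using (s4Kernels_normal i).conj_mem x hx g⁻¹

/-- `a₀ ∈ N₀`. [folklore] -/
theorem a0_mem_N0 : a 0 ∈ s4Kernels 0 := of_mem_s4Kernels 0 (by decide)
/-- `a₁ ∈ N₀`. [folklore] -/
theorem a1_mem_N0 : a 1 ∈ s4Kernels 0 := of_mem_s4Kernels 0 (by decide)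
/-- `b₂ ∈ N₀`. [folklore] -/
theorem b2_mem_N0 : b 2 ∈ s4Kernels 0 := of_mem_s4Kernels 0 (by decide)
/-- `a₀ ∈ N₁`. [folklore] -/
theorem a0_mem_N1 : a 0 ∈ s4Kernels 1 := of_mem_s4Kernels 1 (by decide)
/-- `a₂ ∈ N₁`. [folklore] -/
theorem a2_mem_N1 : a 2 ∈ s4Kernels 1 := of_mem_s4Kernels 1 (by decide)
/-- `a₁ ∈ N₂`. [folklore] -/
theorem a1_mem_N2 : a 1 ∈ s4Kernels 2 := of_mem_s4Kernels 2 (by decide)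
/-- `a₂ ∈ N₂`. [folklore] -/
theorem a2_mem_N2 : a 2 ∈ s4Kernels 2 := of_mem_s4Kernels 2 (by decide)

/-- An automorphism whose generator images and inverse images stay in `Nᵢ` stabilises `Nᵢ`.
[folklore] -/
theorem map_s4Kernels_eq_of_gens (φ : S ≃* S) (i : Fin 3)
    (h : ∀ p ∈ s4Gens i, φ (PresentedGroup.of p) ∈ s4Kernels i)
    (h' : ∀ p ∈ s4Gens i, φ.symm (PresentedGroup.of p) ∈ s4Kernels i) :
    (s4Kernels i).map φ.toMonoidHom = s4Kernels i := by
  have key : ∀ χ : S ≃* S, (∀ p ∈ s4Gens i, χ (PresentedGroup.of p) ∈ s4Kernels i) →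
      (s4Kernels i).map χ.toMonoidHom ≤ s4Kernels i := by
    intro χ hχ
    rw [s4Kernels_eq i, Subgroup.map_normalClosure _ _ χ.surjective]
    refine Subgroup.normalClosure_le_normal ?_
    rintro _ ⟨_, ⟨p, hp, rfl⟩, rfl⟩
    rw [← s4Kernels_eq i]
    exact hχ p hp
  refine le_antisymm (key φ h) ?_
  have hid : φ.toMonoidHom.comp φ.symm.toMonoidHom = MonoidHom.id _ := by ext x; simp
  calc s4Kernels i = ((s4Kernels i).map φ.symm.toMonoidHom).map φ.toMonoidHom := by
        rw [Subgroup.map_map, hid, Subgroup.map_id]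
    _ ≤ (s4Kernels i).map φ.toMonoidHom := Subgroup.map_mono (key φ.symm h')

/-- **`σ₀₁` stabilises all three standard kernels**: it is a symmetry of the standard genus-3
trisection of `S⁴` (an element of `Stab N₀ ∩ Stab N₁ ∩ Stab N₂`). [folklore] -/
theorem slide01_stab (i : Fin 3) : (s4Kernels i).map slide01.toMonoidHom = s4Kernels i := by
  have g02 : ∀ i : Fin 3, ∀ p ∈ s4Gens i, ∀ (P : surfaceGen 3 → Prop),
      (((0 : Fin 3), false) ∈ s4Gens i → P (0, false)) → (((0 : Fin 3), true) ∈ s4Gens i → P (0, true)) →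
      (((1 : Fin 3), false) ∈ s4Gens i → P (1, false)) → (((1 : Fin 3), true) ∈ s4Gens i → P (1, true)) →
      (((2 : Fin 3), false) ∈ s4Gens i → P (2, false)) → (((2 : Fin 3), true) ∈ s4Gens i → P (2, true)) →
      P p := by
    intro i p hp P h0 h1 h2 h3 h4 h5
    revert hp
    exact surfaceGen_three_cases (P := fun p => p ∈ s4Gens i → P p) h0 h1 h2 h3 h4 h5 p
  refine map_s4Kernels_eq_of_gens slide01 i
    (fun p hp => g02 i p hp (fun q => slide01 (PresentedGroup.of q) ∈ s4Kernels i) ?_ ?_ ?_ ?_ ?_ ?_)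
    (fun p hp => g02 i p hp (fun q => slide01.symm (PresentedGroup.of q) ∈ s4Kernels i)
      ?_ ?_ ?_ ?_ ?_ ?_) <;> intro hm <;> fin_cases i <;>
    first
    | exact absurd hm (by decide)
    | simp only [of_eq_a, of_eq_b, slide01_a0, slide01_b0, slide01_a1, slide01_b1, slide01_a2,
        slide01_b2, slide01_symm_a0, slide01_symm_b0, slide01_symm_a1, slide01_symm_b1,
        slide01_symm_a2, slide01_symm_b2]
  -- forward images
  · exact a0_mem_N0
  · exact a0_mem_N1
  · exact Subgroup.mul_mem _ (conj_mem_N' 2 a1_mem_N2 (a 0)) b0_mem_N2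
  · exact conj_mem_N' 0 a1_mem_N0 (a 0)
  · exact conj_mem_N' 2 a1_mem_N2 (a 0)
  · exact Subgroup.mul_mem _ (conj_mem_N 1 b1_mem_N1 (a 1)) a0_mem_N1
  · exact conj_mem_N 1 a2_mem_N1 (a 1)
  · exact conj_mem_N 2 a2_mem_N2 (a 1)
  · exact conj_mem_N 0 b2_mem_N0 (a 1)
  -- inverse images
  · exact a0_mem_N0
  · exact a0_mem_N1
  · exact Subgroup.mul_mem _ (Subgroup.inv_mem _ a1_mem_N2) b0_mem_N2
  · exact conj_mem_N 0 a1_mem_N0 (a 0)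
  · exact conj_mem_N 2 a1_mem_N2 (a 0)
  · have h1 := conj_mem_N 1 b1_mem_N1 (a 0 * (a 1)⁻¹ * (a 0)⁻¹)
    have h2 := conj_mem_N 1 (Subgroup.inv_mem _ a0_mem_N1) (a 0 * (a 1)⁻¹)
    have e : (a 0 : S) * (a 1)⁻¹ * (a 0)⁻¹ * b 1 * a 1 * (a 0)⁻¹ =
        a 0 * (a 1)⁻¹ * (a 0)⁻¹ * b 1 * (a 0 * (a 1)⁻¹ * (a 0)⁻¹)⁻¹ *
          (a 0 * (a 1)⁻¹ * (a 0)⁻¹ * (a 0 * (a 1)⁻¹)⁻¹) := by group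
    rw [e]
    exact Subgroup.mul_mem _ h1 h2
  · have := conj_mem_N 1 a2_mem_N1 (a 0 * (a 1)⁻¹ * (a 0)⁻¹)
    simpa [mul_assoc] using this
  · have := conj_mem_N 2 a2_mem_N2 (a 0 * (a 1)⁻¹ * (a 0)⁻¹)
    simpa [mul_assoc] using this
  · have := conj_mem_N 0 b2_mem_N0 (a 0 * (a 1)⁻¹ * (a 0)⁻¹)
    simpa [mul_assoc] using this

/-! ## `σ₀₁` on homology: the unipotent `b₀ ↦ b₀ + a₁`, `b₁ ↦ b₁ + a₀` -/

/-- The unipotent change of generator values induced by `σ₀₁` on homs to a commutative group: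
`v ↦ v'` with `v'(b₀) = v(a₁)v(b₀)`, `v'(b₁) = v(b₁)v(a₀)`, all other values unchanged. [folklore] -/
def slideVal {A : Type*} [CommGroup A] (v : surfaceGen 3 → A) : surfaceGen 3 → A
  | (0, true) => v (1, false) * v (0, true)
  | (1, true) => v (1, true) * v (0, false)
  | p => v p

/-- **`σ₀₁` acts on every abelian quotient by the transvection `u`:** `χ_v ∘ σ₀₁ = χ_{u·v}`.
In particular on `H₁(S₃) ⊗ R` it is `b₀ ↦ b₀ + a₁`, `b₁ ↦ b₁ + a₀`, identity on the other
classes — a UNIPOTENT symmetry of the three Lagrangian shadows, and it lifts (it IS `σ₀₁`).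
[folklore] -/
theorem toCommGroup_comp_slide01 {A : Type*} [CommGroup A] (v : surfaceGen 3 → A) :
    (SurfaceGroup.toCommGroup v).comp slide01.toMonoidHom = SurfaceGroup.toCommGroup (slideVal v) := by
  refine PresentedGroup.ext (surfaceGen_three_cases ?_ ?_ ?_ ?_ ?_ ?_) <;>
    simp only [MonoidHom.comp_apply, MulEquiv.coe_toMonoidHom, of_eq_a, of_eq_b, slide01_a0,
      slide01_b0, slide01_a1, slide01_b1, slide01_a2, slide01_b2, map_mul, map_inv,
      SurfaceGroup.toCommGroup_a, SurfaceGroup.toCommGroup_b, slideVal] <;>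
    simp [mul_comm, mul_left_comm]

/-- **Sharpness of the units obstruction at the abelian level (key lemma).** The unipotent level
symmetry `u` (`b₀ ↦ b₀ + a₁`, `b₁ ↦ b₁ + a₀`) of the three Lagrangian shadows LIFTS to an actual
symmetry of the standard genus-3 trisection, at every abelian level at once: `σ₀₁` stabilises
`N₀, N₁, N₂` and `χ_v ∘ σ₀₁ = χ_{u·v}` for every hom to a commutative group. Together with the handle
symmetries this gives all three unipotent directions, so modulo SIGNS AND UNITS every symmetry of the
abelian shadow triple lifts: the units obstruction of `LevelSymmetriesFalse.lean` is the only
abelian-level one (Disproof.lean §6). [folklore] -/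
theorem unipotent_level_symmetry_lifts (A : Type*) [CommGroup A] :
    ∃ σ : S ≃* S, (∀ i, (s4Kernels i).map σ.toMonoidHom = s4Kernels i) ∧
      ∀ v : surfaceGen 3 → A,
        (SurfaceGroup.toCommGroup v).comp σ.toMonoidHom = SurfaceGroup.toCommGroup (slideVal v) :=
  ⟨slide01, slide01_stab, toCommGroup_comp_slide01⟩

end Summit.SmoothPoincare4.SmoothPoincare4.Theorems.ShadowApproximation.Negative

end
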